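import Mathlib.CategoryTheory.ConcreteCategory.EpiMono
import Mathlib.CategoryTheory.ConcreteCategory.Elementwise
import Mathlib.Algebra.Category.Grp.FilteredColimits
import Literature.AlgebraicGeometry.Motives.CohomologyColimits
import HarnessLib

/-!
# Cohomology commutes with filtered direct limits on a noetherian space (Hartshorne III.2.9)

Topic: `Literature/AlgebraicGeometry/Motives` (support file for `GrothendieckVanishing.lean`; this file
discharges the named fact `Literature.AlgebraicGeometry.Motives.preservesColimitsOfShape_functorH`,
Hartshorne, *Algebraic Geometry*, III, Prop. 2.9, in its isomorphism form; the vanishing form used in the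
proof of III.2.7 is `subsingleton_H_succ_of_isColimit` in `CohomologyColimits.lean`).

Setting. `X : TopCat.{u}` noetherian; sheaves of abelian groups are the objects of
`Sheaf (Opens.grothendieckTopology X) AddCommGrpCat.{u}`; `A` is a small filtered category (e.g. a
nonempty directed preorder) and `F : A ⥤ Sheaf _ AddCommGrpCat` a direct system `(ℱ_a)` with colimit
cocone `c` (`c.pt = lim→ ℱ_a`); `Hⁿ(X, ·)` is Mathlib's `Sheaf.H` / `Sheaf.functorH`.

**Proposition III.2.9.** On a noetherian space the natural maps `lim→ Hⁿ(X, ℱ_a) → Hⁿ(X, lim→ ℱ_a)`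
are isomorphisms for all `n ≥ 0`.

The printed proof (p. 209): for `n = 0` this is II, Ex. 1.11; both sides are `δ`-functors on the
category of direct systems (`lim→` is exact) which are effaceable for `n > 0` — embed a system
*functorially* into flasque sheaves `ℱ_a ↪ 𝒢_a` (sheaves of discontinuous sections); `lim→ Hⁿ(𝒢_a) = 0`
by III.2.5 and `Hⁿ(lim→ 𝒢_a) = 0` by III.2.8 and III.2.5 — hence both are universal and the natural map
between them, an isomorphism in degree `0`, is an isomorphism (III.1.3A).

The formalization unwinds the appeal to universal `δ`-functors into the usual dimension shifting along
the same functorial effacement (here `ℱ_a ↪ 𝒢_a := ∏_{ℱ_a ⟶ E} E` for an injective cogenerator `E`,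
`exists_functorial_injective_embedding_sheaf`; injective sheaves are flasque, III.2.4): with
`𝒬_a = 𝒢_a / ℱ_a`, the sequence `0 → lim→ ℱ_a → lim→ 𝒢_a → lim→ 𝒬_a → 0` is exact (AB5) with flasque,
hence acyclic, middle term (III.2.8, III.2.5), the maps of the cocone and the transition maps give
morphisms of short exact sequences, and the connecting homomorphisms of the long exact `Ext`-sequences
are compatible with them (Mathlib's `ShortExact.extClass_naturality`). In elementwise terms the
statement "`lim→ Hⁿ(X, ℱ_a) → Hⁿ(X, lim→ ℱ_a)` is bijective" is the conjunction of

* joint surjectivity: every class in `Hⁿ(X, lim→ ℱ_a)` comes from some `Hⁿ(X, ℱ_a)`, and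
* the kernel condition: a class in `Hⁿ(X, ℱ_a)` which dies in `Hⁿ(X, lim→ ℱ_a)` already dies in some
  `Hⁿ(X, ℱ_b)`,

and these are proved for all systems simultaneously by induction on `n` (`H_colimit_surj_and_ker`):
degree `0` from the sections of `lim→ ℱ_a` (II, Ex. 1.11, `exists_rep_of_isColimit`,
`rep_eq_iff_of_isColimit`, transported along `Sheaf.H.equiv₀ : H⁰ ≃ Γ`), and degree `n + 1` from degree
`n` for the systems `(𝒢_a)` and `(𝒬_a)` by a diagram chase through the connecting homomorphisms
(`H_succ_colimit_surj_and_ker`). Finally a functor to abelian groups satisfying the two conditions on a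
cocone over a filtered diagram maps it to a colimit cocone
(`isColimit_mapCocone_of_forall_exists_of_ker`), which gives `PreservesColimitsOfShape A (Sheaf.functorH _ n)`
(`preservesColimitsOfShape_functorH_of_isFiltered`) and the named fact
(`preservesColimitsOfShape_functorH_holds`).

## References

* R. Hartshorne, *Algebraic Geometry*, GTM 52, Springer (1977), doi:10.1007/978-1-4757-3849-0,
  III.2, Prop. 2.9, p. 209 (PDF p. 264); II, Ex. 1.11 (p. 67). [Hartshorne1977]
-/

open CategoryTheory Limits Opposite TopologicalSpace Abelian

universe w v' u' u

namespace Literature.AlgebraicGeometry.Motives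

/-! ### Two consequences of the covariant long exact `Ext`-sequence -/

section ExtSequence

variable {C : Type u'} [Category.{v'} C] [Abelian C] [HasExt.{w} C]

/-- Naturality of the connecting homomorphism `δ : Extⁿ(A, X₃) → Extⁿ⁺¹(A, X₁)`, `x ↦ x · [S]`, of the
covariant long exact `Ext`-sequence with respect to a morphism `φ : S₁ ⟶ S₂` of short exact sequences:
`δ₁(x) · φ.τ₁ = δ₂(x · φ.τ₃)` (from Mathlib's `ShortExact.extClass_naturality`,
`[S₁] · φ.τ₁ = φ.τ₃ · [S₂]`). [folklore] -/
theorem Ext.comp_extClass_comp_mk₀ {S₁ S₂ : ShortComplex C} (h₁ : S₁.ShortExact)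
    (h₂ : S₂.ShortExact) (φ : S₁ ⟶ S₂) {A : C} {n m : ℕ} (x : Ext A S₁.X₃ n) (h : n + 1 = m) :
    (x.comp h₁.extClass h).comp (Ext.mk₀ φ.τ₁) (add_zero m) =
      (x.comp (Ext.mk₀ φ.τ₃) (add_zero n)).comp h₂.extClass h := by
  rw [Ext.comp_assoc_of_third_deg_zero, h₁.extClass_naturality h₂ φ,
    ← Ext.comp_assoc_of_second_deg_zero]

/-- For a short exact `S : 0 → X₁ → X₂ → X₃ → 0`, the composite
`Extⁿ(A, X₂) → Extⁿ(A, X₃) → Extⁿ⁺¹(A, X₁)` of the covariant long exact sequence is zero: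
`(w · S.g) · [S] = 0`. [folklore] -/
theorem Ext.comp_mk₀_comp_extClass {S : ShortComplex C} (hS : S.ShortExact) {A : C} {n m : ℕ}
    (w : Ext A S.X₂ n) (h : n + 1 = m) :
    (w.comp (Ext.mk₀ S.g) (add_zero n)).comp hS.extClass h = 0 := by
  rw [Ext.comp_assoc_of_second_deg_zero, hS.comp_extClass, Ext.comp_zero]

end ExtSequence

/-! ### Filtered colimits of abelian groups, elementwise -/

section AddCommGrpColimit

variable {J : Type u} [SmallCategory J] [IsFiltered J] {C : Type u'} [Category.{v'} C]

/-- Let `G : C ⥤ Ab` be a functor and `c` a cocone over a filtered diagram `F : J ⥤ C`. If (1) every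
element of `G(c.pt)` is in the image of some `G(F_j) → G(c.pt)` and (2) every element of some `G(F_j)`
which vanishes in `G(c.pt)` already vanishes in some `G(F_k)`, `j → k`, then `G` maps `c` to a colimit
cocone: indeed the canonical comparison map `colim (F ⋙ G) → G(c.pt)` is then bijective. [folklore] -/
theorem isColimit_mapCocone_of_forall_exists_of_ker (G : C ⥤ AddCommGrpCat.{u}) {F : J ⥤ C}
    (c : Cocone F)
    (hsurj : ∀ x : G.obj c.pt, ∃ (j : J) (y : G.obj (F.obj j)), G.map (c.ι.app j) y = x)
    (hker : ∀ (j : J) (y : G.obj (F.obj j)), G.map (c.ι.app j) y = 0 →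
      ∃ (k : J) (f : j ⟶ k), G.map (F.map f) y = 0) :
    Nonempty (IsColimit (G.mapCocone c)) := by
  have hφ : Function.Bijective (colimit.desc (F ⋙ G) (G.mapCocone c)) := by
    refine ⟨(injective_iff_map_eq_zero _).mpr fun t ht => ?_, fun x => ?_⟩
    · obtain ⟨j, y, rfl⟩ := Concrete.colimit_exists_rep (F ⋙ G) t
      rw [colimit.ι_desc_apply] at ht
      obtain ⟨k, f, hf⟩ := hker j y ht
      rw [← colimit.w_apply (F ⋙ G) f]
      exact (congrArg (colimit.ι (F ⋙ G) k) hf).trans (map_zero _)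
    · obtain ⟨j, y, rfl⟩ := hsurj x
      exact ⟨colimit.ι (F ⋙ G) j y, colimit.ι_desc_apply (G.mapCocone c) j y⟩
  haveI : IsIso ((colimit.isColimit (F ⋙ G)).desc (G.mapCocone c)) := by
    haveI : IsIso ((forget AddCommGrpCat.{u}).map
        ((colimit.isColimit (F ⋙ G)).desc (G.mapCocone c))) :=
      (isIso_iff_bijective _).mpr hφ
    exact isIso_of_reflects_iso _ (forget AddCommGrpCat.{u})
  exact ⟨IsColimit.ofPointIso (colimit.isColimit (F ⋙ G))⟩

end AddCommGrpColimit

/-! ### Hartshorne III.2.9 -/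

section

variable {X : TopCat.{u}} {A : Type u} [SmallCategory A] [IsFiltered A]

omit [IsFiltered A] in
/-- Elementwise cocone relation on cohomology: for `l : j ⟶ k` and `w ∈ Hⁿ(X, ℱ_j)`, the image of
`ℱ_l(w)` under `ℱ_k → c.pt` is the image of `w` under `ℱ_j → c.pt`. [folklore] -/
theorem H_map_ι_map_apply (F : A ⥤ Sheaf (Opens.grothendieckTopology X) AddCommGrpCat.{u})
    (c : Cocone F) {j k : A} (l : j ⟶ k) (n : ℕ) (w : (F.obj j).H n) :
    Sheaf.H.map (c.ι.app k) n (Sheaf.H.map (F.map l) n w) = Sheaf.H.map (c.ι.app j) n w := by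
  rw [← Sheaf.H.map_comp_apply]
  exact congrArg (Sheaf.H.map · n w) (c.w l)

/-- For a cocone `c` over a filtered system `(ℱ_a)` of abelian sheaves, the kernel condition in degree
`n` ("a class in `Hⁿ(X, ℱ_a)` dying in `Hⁿ(X, c.pt)` dies in some `Hⁿ(X, ℱ_b)`") implies its two-element
form: two classes at stages `a`, `b` with the same image in `Hⁿ(X, c.pt)` agree at a common later
stage (subtract at a common stage, `IsFiltered.max`). [folklore] -/
theorem H_map_eq_of_map_ι_eq (F : A ⥤ Sheaf (Opens.grothendieckTopology X) AddCommGrpCat.{u})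
    (c : Cocone F) (n : ℕ)
    (hker : ∀ (a : A) (y : (F.obj a).H n), Sheaf.H.map (c.ι.app a) n y = 0 →
      ∃ (b : A) (f : a ⟶ b), Sheaf.H.map (F.map f) n y = 0)
    {a b : A} (y : (F.obj a).H n) (y' : (F.obj b).H n)
    (e : Sheaf.H.map (c.ι.app a) n y = Sheaf.H.map (c.ι.app b) n y') :
    ∃ (k : A) (f : a ⟶ k) (g : b ⟶ k),
      Sheaf.H.map (F.map f) n y = Sheaf.H.map (F.map g) n y' := by
  obtain ⟨k, h, hk⟩ := hker (IsFiltered.max a b)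
    (Sheaf.H.map (F.map (IsFiltered.leftToMax a b)) n y -
      Sheaf.H.map (F.map (IsFiltered.rightToMax a b)) n y') (by
      rw [map_sub, sub_eq_zero, H_map_ι_map_apply, H_map_ι_map_apply]
      exact e)
  refine ⟨k, IsFiltered.leftToMax a b ≫ h, IsFiltered.rightToMax a b ≫ h, ?_⟩
  rw [F.map_comp, F.map_comp, Sheaf.H.map_comp_apply, Sheaf.H.map_comp_apply, ← sub_eq_zero,
    ← map_sub]
  exact hk

variable [NoetherianSpace X]

/-- **Hartshorne III.2.9 in degree `0`** (i.e. II, Ex. 1.11, `Γ(X, lim→ ℱ_a) = lim→ Γ(X, ℱ_a)` on a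
noetherian space, transported along `H⁰(X, ·) ≃ Γ(X, ·)`): for a colimit cocone `c` of a filtered
system of abelian sheaves on a noetherian space, every class in `H⁰(X, c.pt)` comes from some
`H⁰(X, ℱ_a)`, and a class in `H⁰(X, ℱ_a)` vanishing in `H⁰(X, c.pt)` vanishes in some `H⁰(X, ℱ_b)`.
[cite: Hartshorne1977, III.2.9] -/
theorem H_zero_colimit_surj_and_ker (F : A ⥤ Sheaf (Opens.grothendieckTopology X) AddCommGrpCat.{u})
    {c : Cocone F} (hc : IsColimit c) :
    (∀ x : c.pt.H 0, ∃ (a : A) (y : (F.obj a).H 0), Sheaf.H.map (c.ι.app a) 0 y = x) ∧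
    (∀ (a : A) (y : (F.obj a).H 0), Sheaf.H.map (c.ι.app a) 0 y = 0 →
      ∃ (b : A) (f : a ⟶ b), Sheaf.H.map (F.map f) 0 y = 0) := by
  constructor
  · intro x
    obtain ⟨a, t, ht⟩ := exists_rep_of_isColimit F hc (op ⊤) (Sheaf.H.equiv₀ c.pt isTerminalTop x)
    refine ⟨a, (Sheaf.H.equiv₀ (F.obj a) isTerminalTop).symm t, ?_⟩
    rw [Sheaf.H.equiv₀_symm_naturality, ht]
    exact (Sheaf.H.equiv₀ c.pt isTerminalTop).symm_apply_apply x
  · intro a y hy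
    have h0 : (c.ι.app a).hom.app (op ⊤) (Sheaf.H.equiv₀ (F.obj a) isTerminalTop y) =
        (c.ι.app a).hom.app (op ⊤) 0 := by
      rw [Sheaf.H.equiv₀_naturality, hy, map_zero, map_zero]
    obtain ⟨k, f, g, e⟩ := (rep_eq_iff_of_isColimit F hc (op ⊤) _ _).mp h0
    refine ⟨k, f, (Sheaf.H.equiv₀ (F.obj k) isTerminalTop).injective ?_⟩
    rw [← Sheaf.H.equiv₀_naturality, e, map_zero, map_zero]

/-- **Hartshorne III.2.9, induction step** (dimension shifting along a functorial flasque effacement,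
as in the printed proof): if, for every filtered system of abelian sheaves on the noetherian space `X`
(indexed by `A`) and every colimit cocone, joint surjectivity and the kernel condition hold for
`Hⁿ(X, ·)`, then they hold for `Hⁿ⁺¹(X, ·)`. With `ℱ_a ↪ 𝒢_a ↠ 𝒬_a` the functorial embedding into
injective (hence flasque, III.2.4) sheaves and `0 → lim→ ℱ_a → lim→ 𝒢_a → lim→ 𝒬_a → 0` (exact by AB5,
middle term flasque by III.2.8, hence acyclic by III.2.5): a class `x ∈ Hⁿ⁺¹(lim→ ℱ_a)` is `δ x₃`,
`x₃ ∈ Hⁿ(lim→ 𝒬_a)` comes from some `y₃ ∈ Hⁿ(𝒬_a)` and `δ y₃ ↦ x`; a class `δ y₃ ∈ Hⁿ⁺¹(ℱ_a)` dying in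
`Hⁿ⁺¹(lim→ ℱ_a)` has `y₃ ↦ x₃` with `δ x₃ = 0`, so `x₃` lifts to `Hⁿ(lim→ 𝒢_a)`, i.e. to some `Hⁿ(𝒢_b)`,
and at a later stage `k` the image of `y₃` lifts to `Hⁿ(𝒢_k)`, so `δ y₃ ↦ 0 ∈ Hⁿ⁺¹(ℱ_k)`.
[cite: Hartshorne1977, III.2.9] -/
theorem H_succ_colimit_surj_and_ker (n : ℕ)
    (ih : ∀ (F : A ⥤ Sheaf (Opens.grothendieckTopology X) AddCommGrpCat.{u}) (c : Cocone F),
      IsColimit c →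
      (∀ x : c.pt.H n, ∃ (a : A) (y : (F.obj a).H n), Sheaf.H.map (c.ι.app a) n y = x) ∧
      (∀ (a : A) (y : (F.obj a).H n), Sheaf.H.map (c.ι.app a) n y = 0 →
        ∃ (b : A) (f : a ⟶ b), Sheaf.H.map (F.map f) n y = 0))
    (F : A ⥤ Sheaf (Opens.grothendieckTopology X) AddCommGrpCat.{u}) {c : Cocone F}
    (hc : IsColimit c) :
    (∀ x : c.pt.H (n + 1), ∃ (a : A) (y : (F.obj a).H (n + 1)),
        Sheaf.H.map (c.ι.app a) (n + 1) y = x) ∧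
    (∀ (a : A) (y : (F.obj a).H (n + 1)), Sheaf.H.map (c.ι.app a) (n + 1) y = 0 →
        ∃ (b : A) (f : a ⟶ b), Sheaf.H.map (F.map f) (n + 1) y = 0) := by
  -- the functorial embedding into injective (hence flasque) sheaves and its cokernel `𝒬 = cokernel φ`
  obtain ⟨Φ, φ₁, hΦ, hφ₁⟩ := exists_functorial_injective_embedding_sheaf (X := X)
  let φ : F ⟶ F ⋙ Φ := { app := fun a => φ₁.app (F.obj a)
                         naturality := fun a b f => φ₁.naturality (F.map f) }
  haveI : ∀ a, Mono (φ.app a) := fun a => hφ₁ _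
  haveI : Mono φ := NatTrans.mono_of_mono_app φ
  let S := ShortComplex.cokernelSequence φ
  have hS : S.ShortExact :=
    { exact := ShortComplex.cokernelSequence_exact φ
      mono_f := inferInstanceAs (Mono φ) }
  haveI : Mono S.f := inferInstanceAs (Mono φ)
  -- the short exact sequences `S_a : 0 → ℱ_a → 𝒢_a → 𝒬_a → 0`
  let Sa : A → ShortComplex (Sheaf (Opens.grothendieckTopology X) AddCommGrpCat.{u}) := fun a =>
    ShortComplex.mk (φ.app a) ((cokernel.π φ).app a) (by
      rw [← NatTrans.comp_app, cokernel.condition]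
      rfl)
  have hSa : ∀ a, (Sa a).ShortExact := fun a => hS.map_of_exact ((evaluation A _).obj a)
  -- the colimit sequence `T : 0 → c.pt → colim 𝒢 → colim 𝒬 → 0`
  let f : c.pt ⟶ colimit (F ⋙ Φ) := hc.map (colimit.cocone _) φ
  let g : colimit (F ⋙ Φ) ⟶ colimit (cokernel φ) := colimMap (cokernel.π φ)
  have hf : ∀ a, c.ι.app a ≫ f = φ.app a ≫ (colimit.cocone (F ⋙ Φ)).ι.app a :=
    fun a => hc.ι_map _ _ a
  have hg : ∀ a, (colimit.cocone (F ⋙ Φ)).ι.app a ≫ g =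
      (cokernel.π φ).app a ≫ (colimit.cocone (cokernel φ)).ι.app a :=
    fun a => ι_colimMap (cokernel.π φ) a
  let T := colim.mapShortComplex S hc (colimit.cocone (F ⋙ Φ)) (colimit.cocone (cokernel φ))
    f g hf hg
  haveI : ∀ a, Epi (S.g.app a) := fun a => (hSa a).epi_g
  have hT : T.ShortExact :=
    { exact := colim.exact_mapShortComplex hS.exact hc (colimit.isColimit _) (colimit.isColimit _)
        f g hf hg
      mono_f := colim.map_mono' S.f hc (colimit.isColimit _) f hf
      epi_g := colim.map_epi' S.g _ (colimit.isColimit _) g hg }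
  haveI : ∀ a, TopCat.Sheaf.IsFlasque ((F ⋙ Φ).obj a) := fun a =>
    @isFlasque_of_injective _ _ (hΦ _)
  haveI : TopCat.Sheaf.IsFlasque T.X₂ := isFlasque_of_isColimit (F ⋙ Φ) (colimit.isColimit _)
  haveI : Subsingleton (T.X₂.H (n + 1)) := subsingleton_H_of_isFlasque _ _ (Nat.succ_pos _)
  haveI : ∀ a, Injective (Sa a).X₂ := fun a => hΦ _
  -- the morphisms of short exact sequences `S_a ⟶ T` (cocone maps) and `S_a ⟶ S_b` (transition
  -- maps), and the compatibility of the connecting homomorphisms with them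
  let ι : ∀ a, Sa a ⟶ T := fun a =>
    { τ₁ := c.ι.app a
      τ₂ := (colimit.cocone (F ⋙ Φ)).ι.app a
      τ₃ := (colimit.cocone (cokernel φ)).ι.app a
      comm₁₂ := hf a
      comm₂₃ := hg a }
  let τ : ∀ {a b : A} (_ : a ⟶ b), Sa a ⟶ Sa b := fun v =>
    { τ₁ := F.map v
      τ₂ := (F ⋙ Φ).map v
      τ₃ := (cokernel φ).map v
      comm₁₂ := φ.naturality v
      comm₂₃ := (cokernel.π φ).naturality v }
  have hδ : ∀ (a : A) (m : ℕ) (z : (Sa a).X₃.H m) (m' : ℕ) (hm : m + 1 = m'),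
      Sheaf.H.map (c.ι.app a) m' (z.comp (hSa a).extClass hm) =
        (Sheaf.H.map ((colimit.cocone (cokernel φ)).ι.app a) m z).comp hT.extClass hm := by
    intro a m z m' hm
    rw [Sheaf.H.map_apply, Sheaf.H.map_apply]
    exact Ext.comp_extClass_comp_mk₀ (hSa a) hT (ι a) z hm
  have hδ' : ∀ {a b : A} (v : a ⟶ b) (m : ℕ) (z : (Sa a).X₃.H m) (m' : ℕ) (hm : m + 1 = m'),
      Sheaf.H.map (F.map v) m' (z.comp (hSa a).extClass hm) =
        (Sheaf.H.map ((cokernel φ).map v) m z).comp (hSa b).extClass hm := by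
    intro a b v m z m' hm
    rw [Sheaf.H.map_apply, Sheaf.H.map_apply]
    exact Ext.comp_extClass_comp_mk₀ (hSa a) (hSa b) (τ v) z hm
  -- degree `n` for the systems `(𝒢_a)` and `(𝒬_a)`
  have surjG := (ih (F ⋙ Φ) _ (colimit.isColimit _)).1
  have ihQ := ih (cokernel φ) _ (colimit.isColimit _)
  constructor
  · -- joint surjectivity in degree `n + 1`
    intro x
    obtain ⟨x₃, rfl⟩ := Ext.covariant_sequence_exact₁ _ hT x (Subsingleton.elim _ _) rfl
    obtain ⟨a, y₃, rfl⟩ := ihQ.1 x₃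
    exact ⟨a, _, hδ a n y₃ (n + 1) rfl⟩
  · -- the kernel condition in degree `n + 1`
    intro a y hy
    obtain ⟨y₃, rfl⟩ := Ext.covariant_sequence_exact₁ _ (hSa a) y (Subsingleton.elim _ _) rfl
    have hy' := (hδ a n y₃ (n + 1) rfl).symm.trans hy
    obtain ⟨x₂, hx₂⟩ := Ext.covariant_sequence_exact₃ _ hT _ rfl hy'
    obtain ⟨b, z, rfl⟩ := surjG x₂
    have h₂ : Sheaf.H.map ((colimit.cocone (cokernel φ)).ι.app b) n
          (Sheaf.H.map ((cokernel.π φ).app b) n z) =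
        Sheaf.H.map ((colimit.cocone (cokernel φ)).ι.app a) n y₃ := by
      rw [← Sheaf.H.map_comp_apply]
      refine (congrArg (Sheaf.H.map · n z) (hg b)).symm.trans ?_
      rw [Sheaf.H.map_comp_apply]
      exact hx₂
    obtain ⟨k, u, v, e⟩ := H_map_eq_of_map_ι_eq (cokernel φ) _ n ihQ.2 _ _ h₂
    refine ⟨k, v, (hδ' v n y₃ (n + 1) rfl).trans ?_⟩
    rw [← e, ← Sheaf.H.map_comp_apply, ← (cokernel.π φ).naturality, Sheaf.H.map_comp_apply,
      Sheaf.H.map_apply ((cokernel.π φ).app k)]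
    exact Ext.comp_mk₀_comp_extClass (hSa k) _ rfl

/-- **Hartshorne III.2.9** (elementwise form): on a noetherian topological space, for a colimit cocone
`c` of a filtered system `(ℱ_a)` of abelian sheaves and every `n`, (1) every class in `Hⁿ(X, lim→ ℱ_a)`
is the image of a class in some `Hⁿ(X, ℱ_a)`, and (2) a class in `Hⁿ(X, ℱ_a)` with zero image in
`Hⁿ(X, lim→ ℱ_a)` has zero image in some `Hⁿ(X, ℱ_b)`; i.e. `lim→ Hⁿ(X, ℱ_a) → Hⁿ(X, lim→ ℱ_a)` is
bijective. By induction on `n` (`H_zero_colimit_surj_and_ker`, `H_succ_colimit_surj_and_ker`).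
[cite: Hartshorne1977, III.2.9] -/
theorem H_colimit_surj_and_ker (n : ℕ) :
    ∀ (F : A ⥤ Sheaf (Opens.grothendieckTopology X) AddCommGrpCat.{u}) (c : Cocone F),
      IsColimit c →
      (∀ x : c.pt.H n, ∃ (a : A) (y : (F.obj a).H n), Sheaf.H.map (c.ι.app a) n y = x) ∧
      (∀ (a : A) (y : (F.obj a).H n), Sheaf.H.map (c.ι.app a) n y = 0 →
        ∃ (b : A) (f : a ⟶ b), Sheaf.H.map (F.map f) n y = 0) := by
  induction n with
  | zero => exact fun F c hc => H_zero_colimit_surj_and_ker F hc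
  | succ n ih => exact fun F c hc => H_succ_colimit_surj_and_ker n ih F hc

/-- **Hartshorne III.2.9**: on a noetherian topological space the cohomology functors
`Hⁿ(X, ·) : 𝔄𝔟(X) ⥤ 𝔄𝔟` (Mathlib's `Sheaf.functorH`) send colimit cocones of filtered systems of abelian
sheaves to colimit cocones, i.e. `lim→ Hⁿ(X, ℱ_a) ≅ Hⁿ(X, lim→ ℱ_a)` via the natural map.
[cite: Hartshorne1977, III.2.9] -/
theorem isColimit_functorH_mapCocone (F : A ⥤ Sheaf (Opens.grothendieckTopology X) AddCommGrpCat.{u})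
    {c : Cocone F} (hc : IsColimit c) (n : ℕ) :
    Nonempty (IsColimit
      ((Sheaf.functorH.{u} (Opens.grothendieckTopology X) n).mapCocone c)) := by
  obtain ⟨hsurj, hker⟩ := H_colimit_surj_and_ker n F c hc
  have e₁ : ∀ {G G' : Sheaf (Opens.grothendieckTopology X) AddCommGrpCat.{u}} (ψ : G ⟶ G')
      (y : G.H n), (Sheaf.functorH.{u} (Opens.grothendieckTopology X) n).map ψ y =
        Sheaf.H.map ψ n y := fun ψ y => rfl
  refine isColimit_mapCocone_of_forall_exists_of_ker _ c (fun x => ?_) (fun a y hy => ?_)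
  · obtain ⟨a, y, hy⟩ := hsurj x
    exact ⟨a, y, (e₁ (c.ι.app a) y).trans hy⟩
  · obtain ⟨b, f, hf⟩ := hker a y ((e₁ (c.ι.app a) y).symm.trans hy)
    exact ⟨b, f, (e₁ (F.map f) y).trans hf⟩

/-- **Hartshorne III.2.9** (functorial form): on a noetherian topological space the cohomology functors
`Hⁿ(X, ·)` (Mathlib's `Sheaf.functorH`) preserve filtered colimits of abelian sheaves (colimits indexed
by a small filtered category, e.g. a nonempty directed set). [cite: Hartshorne1977, III.2.9] -/
theorem preservesColimitsOfShape_functorH_of_isFiltered (n : ℕ) :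
    PreservesColimitsOfShape A (Sheaf.functorH.{u} (Opens.grothendieckTopology X) n) where
  preservesColimit {F} := ⟨fun {_} hc => isColimit_functorH_mapCocone F hc n⟩

end

section NamedFact

/-- **Hartshorne III.2.9**, in the form of the named fact
`Literature.AlgebraicGeometry.Motives.preservesColimitsOfShape_functorH` of `GrothendieckVanishing.lean`:
on a noetherian topological space `X`, for every nonempty directed preorder `A` and every `i`, the
cohomology functor `Hⁱ(X, ·)` preserves colimits indexed by `A`, i.e. the natural maps
`lim→ Hⁱ(X, ℱ_α) → Hⁱ(X, lim→ ℱ_α)` are isomorphisms. [cite: Hartshorne1977, III.2.9] -/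
theorem preservesColimitsOfShape_functorH_holds : preservesColimitsOfShape_functorH.{u} :=
  fun _X _ _A _ _ _ i => preservesColimitsOfShape_functorH_of_isFiltered i

end NamedFact

end Literature.AlgebraicGeometry.Motives
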